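import Mathlib
import HarnessLib

/-!
# Route `SqueezeCycle`, crux `ExtremalBiaxialitySubcritical` — exact strain algebra on `sl(3, ℝ)`

Helper file for item `stmt-NavierStokesRegularity-11609`
(`Summit.NavierStokesRegularity.NavierStokesRegularity.Theses.SqueezeCycle.ExtremalBiaxialitySubcritical`):
the two pieces of exact `3 × 3` algebra used by the crux idea card `quarter-bootstrap-pinning`
(its "first lemma" `production_identity` and the constraint `σ ≥ 6ℓ²` of its deficit bound) and by
the sibling crux `MustSqueeze` (the local enstrophy-production density in terms of the middle strain
eigenvalue). For a real `3 × 3` matrix `A` (velocity gradient) put `M = A + Aᵀ = 2S` and let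
`μ₀ ≥ μ₁ ≥ μ₂` be Mathlib's antitone eigenvalues `(Matrix.isHermitian_add_transpose_self A).eigenvalues₀`
(so the strain eigenvalues are `λᵢ = μᵢ/2`).

* `sum_sq_entries_eq_sum_eigenvalues_sq` — for every real symmetric matrix, `∑ᵢⱼ Mᵢⱼ² = ∑ₖ μₖ²`
  (Frobenius norm through the spectral theorem; any size).
* `production_identity` — for trace-free `A`: `−4 det S = μ₁ · |S|²_F − ½ μ₁³`
  (equivalently `−4 det S = 2λ₂|S|² − 4λ₂³`): the characteristic polynomial of the trace-free
  symmetric `S` evaluated through `λ₀λ₂ = λ₁² − ½|S|²`. With Betchov's `ω·Sω = 4 det ∇u − 4 det S`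
  this writes the local production density as `2λ₂(|S|² − 2λ₂²)`, signed by the middle eigenvalue.
* `six_mul_sq_mid_le_sum_sq` — for a sorted zero-sum triple, `6 μ₁² ≤ μ₀² + μ₁² + μ₂²`; hence
  `six_mul_midStrain_sq_le` : `6 λ₂(S)² ≤ |S|²_F` for trace-free `A` (the factor `|S|² − 2λ₂²` in the
  production density is `≥ 4λ₂² ≥ 0`, and in the `Λ`-equation the local restricted-Euler source
  `⅓|𝔖|² − Λ²` is `≥ Λ²`).
-/

namespace Summit.NavierStokesRegularity.NavierStokesRegularity.Theorems

open scoped Matrix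
open Matrix

/-! ### Frobenius norm of a symmetric matrix through its eigenvalues -/

/-- **`∑ᵢⱼ Mᵢⱼ² = ∑ₖ μₖ²` for a real symmetric matrix** (`μ = hM.eigenvalues`): the left side is
`tr (M M)` and, diagonalising `M = U D U⋆` (`Matrix.IsHermitian.spectral_theorem`),
`tr (M M) = tr (U D² U⋆) = tr (D²)`. [folklore] -/
theorem sum_sq_entries_eq_sum_eigenvalues_sq {n : Type*} [Fintype n] [DecidableEq n]
    {M : Matrix n n ℝ} (hM : M.IsHermitian) :
    ∑ i, ∑ j, M i j ^ 2 = ∑ k, hM.eigenvalues k ^ 2 := by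
  -- `∑ Mᵢⱼ² = tr (M * M)` (using symmetry `M j i = M i j`)
  have hsymm : ∀ i j, M j i = M i j := fun i j => by
    have h := hM.apply i j
    simpa using h
  have h1 : ∑ i, ∑ j, M i j ^ 2 = (M * M).trace := by
    simp only [Matrix.trace, Matrix.diag, Matrix.mul_apply, pow_two]
    refine Finset.sum_congr rfl fun i _ => Finset.sum_congr rfl fun j _ => ?_
    rw [hsymm i j]
  -- diagonalise
  set U := hM.eigenvectorUnitary with hU
  set D : Matrix n n ℝ := diagonal (RCLike.ofReal ∘ hM.eigenvalues) with hD
  have hsp : M = Unitary.conjStarAlgAut ℝ _ U D := hM.spectral_theorem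
  have hMM : M * M = Unitary.conjStarAlgAut ℝ _ U (D * D) := by
    rw [map_mul, ← hsp]
  rw [h1, hMM, Unitary.conjStarAlgAut_apply, Matrix.trace_mul_cycle, Unitary.coe_star_mul_self,
    one_mul, hD, diagonal_mul_diagonal, trace_diagonal]
  simp [pow_two]

/-! ### The production identity -/

/-- Bookkeeping on `Fin n` with `n = 3`: an antitone `f : Fin n → ℝ` has
`∏ f = f 0 * f 1 * f 2`, `∑ f = f 0 + f 1 + f 2`, `∑ f² = f 0² + f 1² + f 2²` and
`f 0 ≥ f 1 ≥ f 2`. [folklore] -/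
theorem antitone_fin_three_bookkeeping' {n : ℕ} (hn : n = 3) [NeZero n] (f : Fin n → ℝ)
    (hf : Antitone f) :
    ∏ j, f j = f 0 * f 1 * f 2 ∧ ∑ j, f j = f 0 + f 1 + f 2 ∧
      ∑ j, f j ^ 2 = f 0 ^ 2 + f 1 ^ 2 + f 2 ^ 2 ∧ f 1 ≤ f 0 ∧ f 2 ≤ f 1 := by
  subst hn
  refine ⟨Fin.prod_univ_three f, Fin.sum_univ_three f, Fin.sum_univ_three _, hf ?_, hf ?_⟩
  · rw [Fin.le_iff_val_le_val]; simp
  · rw [Fin.le_iff_val_le_val]; simp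

/-- **The production identity** (card `quarter-bootstrap-pinning`, first lemma; Miller 2019 §1 /
Neustupa–Penel 2001 for the inequality shadow `−det S ≤ ½|S|²λ₂⁺`): for a trace-free real `3 × 3`
matrix `A`, with `S = ½(A + Aᵀ)` and `μ₀ ≥ μ₁ ≥ μ₂` the eigenvalues of `A + Aᵀ = 2S`,
`−4 det S = μ₁ · ∑ᵢⱼ Sᵢⱼ² − ½ μ₁³` (i.e. `−4 det S = 2λ₂|S|² − 4λ₂³` with `λ₂ = μ₁/2` the middle
strain eigenvalue). Proof: `det S = ⅛ μ₀μ₁μ₂`, `∑ Sᵢⱼ² = ¼ ∑ μₖ²` (`sum_sq_entries_eq_sum_eigenvalues_sq`)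
and `μ₀ + μ₁ + μ₂ = 2 tr A = 0`, so `μ₀μ₂ = ½(μ₁² − μ₀² − μ₂²)`. [cite: Miller2019, §1 (the identity behind Lemma 1.1 / Thm 1.1), doi:10.1007/s00205-019-01419-z] -/
theorem production_identity (A : Matrix (Fin 3) (Fin 3) ℝ) (hA : A.trace = 0) :
    -4 * (((1 / 2 : ℝ) • (A + Aᵀ))).det =
      (Matrix.isHermitian_add_transpose_self A).eigenvalues₀ 1 *
          (∑ i, ∑ j, (((1 / 2 : ℝ) • (A + Aᵀ)) i j) ^ 2) -
        (1 / 2) * (Matrix.isHermitian_add_transpose_self A).eigenvalues₀ 1 ^ 3 := by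
  set hM := Matrix.isHermitian_add_transpose_self A
  set e : Fin (Fintype.card (Fin 3)) ≃ Fin 3 := Fintype.equivOfCardEq (Fintype.card_fin _)
  have key : ∀ j, hM.eigenvalues (e j) = hM.eigenvalues₀ j := fun j => by
    simp [Matrix.IsHermitian.eigenvalues, e]
  have hHT : A + Aᴴ = A + Aᵀ := by rw [Matrix.conjTranspose_eq_transpose_of_trivial]
  -- determinant, trace and Frobenius norm through the eigenvalues
  have hdet : (A + Aᵀ).det = ∏ j, hM.eigenvalues₀ j := by
    rw [← hHT, hM.det_eq_prod_eigenvalues, ← e.prod_comp]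
    simp only [RCLike.ofReal_real_eq_id, id_eq, key]
  have htr : (A + Aᵀ).trace = ∑ j, hM.eigenvalues₀ j := by
    rw [← hHT, hM.trace_eq_sum_eigenvalues, ← e.sum_comp]
    simp only [RCLike.ofReal_real_eq_id, id_eq, key]
  have hfrob : ∑ i, ∑ j, (A + Aᵀ) i j ^ 2 = ∑ k, hM.eigenvalues₀ k ^ 2 := by
    have h := sum_sq_entries_eq_sum_eigenvalues_sq hM
    have hent : ∑ i, ∑ j, (A + Aᵀ) i j ^ 2 = ∑ i, ∑ j, (A + Aᴴ) i j ^ 2 := by rw [hHT]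
    rw [hent, h, ← e.sum_comp]
    simp only [key]
  have htr0 : (A + Aᵀ).trace = 0 := by
    rw [Matrix.trace_add, Matrix.trace_transpose, hA, add_zero]
  obtain ⟨hp, hs, hs2, -, -⟩ :=
    antitone_fin_three_bookkeeping' (Fintype.card_fin 3) hM.eigenvalues₀ hM.eigenvalues₀_antitone
  set μ := hM.eigenvalues₀
  have hsum : μ 0 + μ 1 + μ 2 = 0 := by rw [← hs, ← htr, htr0]
  -- the smul factors
  have hsm : ((1 / 2 : ℝ) • (A + Aᵀ)).det = (1 / 2) ^ 3 * (A + Aᵀ).det := by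
    rw [Matrix.det_smul, Fintype.card_fin]
  have hsq : ∑ i, ∑ j, (((1 / 2 : ℝ) • (A + Aᵀ)) i j) ^ 2 = (1 / 4) * ∑ i, ∑ j, (A + Aᵀ) i j ^ 2 := by
    rw [Finset.mul_sum]
    refine Finset.sum_congr rfl fun i _ => ?_
    rw [Finset.mul_sum]
    refine Finset.sum_congr rfl fun j _ => ?_
    rw [Matrix.smul_apply, smul_eq_mul]
    ring
  rw [hsm, hdet, hp, hsq, hfrob, hs2]
  have h2 : μ 2 = -μ 0 - μ 1 := by linarith
  rw [h2]
  ring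

/-! ### The middle eigenvalue is dominated by the Frobenius norm -/

/-- **A sorted zero-sum triple has `6 μ₁² ≤ μ₀² + μ₁² + μ₂²`**: if `μ₀ ≥ μ₁ ≥ μ₂` and
`μ₀ + μ₁ + μ₂ = 0` then, say for `μ₁ ≥ 0`, `|μ₂| = μ₀ + μ₁ ≥ 2μ₁` and `μ₀ ≥ μ₁`, so
`μ₀² + μ₂² ≥ 5μ₁²` (symmetrically for `μ₁ ≤ 0`). Equality at the axisymmetric shapes `(1,1,−2)`,
`(2,−1,−1)`. [folklore] -/
theorem six_mul_sq_mid_le_sum_sq {a b c : ℝ} (hab : b ≤ a) (hbc : c ≤ b) (h0 : a + b + c = 0) :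
    6 * b ^ 2 ≤ a ^ 2 + b ^ 2 + c ^ 2 := by
  rcases le_or_gt 0 b with hb | hb
  · nlinarith [mul_nonneg hb (sub_nonneg.2 hab)]
  · nlinarith [mul_nonneg (neg_nonneg.2 hb.le) (sub_nonneg.2 hbc)]

/-- **`6 λ₂(S)² ≤ |S|²_F` for a trace-free velocity gradient**: with `μ = eigenvalues₀ (A + Aᵀ)`,
`(3/2) μ₁² ≤ ∑ᵢⱼ Sᵢⱼ²`, `S = ½(A + Aᵀ)` (i.e. `6λ₂² ≤ |S|²` with `λ₂ = μ₁/2`): the factor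
`|S|² − 2λ₂²` of the production density `2λ₂(|S|² − 2λ₂²)` (`production_identity`) is at least
`4λ₂² ≥ 0`, so the local production carries exactly the sign of the middle eigenvalue, and a biaxially
strained point (`λ₂` large) has large strain. [folklore] -/
theorem six_mul_midStrain_sq_le (A : Matrix (Fin 3) (Fin 3) ℝ) (hA : A.trace = 0) :
    (3 / 2) * (Matrix.isHermitian_add_transpose_self A).eigenvalues₀ 1 ^ 2 ≤
      ∑ i, ∑ j, (((1 / 2 : ℝ) • (A + Aᵀ)) i j) ^ 2 := by
  set hM := Matrix.isHermitian_add_transpose_self A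
  set e : Fin (Fintype.card (Fin 3)) ≃ Fin 3 := Fintype.equivOfCardEq (Fintype.card_fin _)
  have key : ∀ j, hM.eigenvalues (e j) = hM.eigenvalues₀ j := fun j => by
    simp [Matrix.IsHermitian.eigenvalues, e]
  have hHT : A + Aᴴ = A + Aᵀ := by rw [Matrix.conjTranspose_eq_transpose_of_trivial]
  have htr : (A + Aᵀ).trace = ∑ j, hM.eigenvalues₀ j := by
    rw [← hHT, hM.trace_eq_sum_eigenvalues, ← e.sum_comp]
    simp only [RCLike.ofReal_real_eq_id, id_eq, key]
  have hfrob : ∑ i, ∑ j, (A + Aᵀ) i j ^ 2 = ∑ k, hM.eigenvalues₀ k ^ 2 := by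
    have h := sum_sq_entries_eq_sum_eigenvalues_sq hM
    have hent : ∑ i, ∑ j, (A + Aᵀ) i j ^ 2 = ∑ i, ∑ j, (A + Aᴴ) i j ^ 2 := by rw [hHT]
    rw [hent, h, ← e.sum_comp]
    simp only [key]
  have htr0 : (A + Aᵀ).trace = 0 := by
    rw [Matrix.trace_add, Matrix.trace_transpose, hA, add_zero]
  obtain ⟨-, hs, hs2, h10, h21⟩ :=
    antitone_fin_three_bookkeeping' (Fintype.card_fin 3) hM.eigenvalues₀ hM.eigenvalues₀_antitone
  set μ := hM.eigenvalues₀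
  have hsum : μ 0 + μ 1 + μ 2 = 0 := by rw [← hs, ← htr, htr0]
  have hsq : ∑ i, ∑ j, (((1 / 2 : ℝ) • (A + Aᵀ)) i j) ^ 2 = (1 / 4) * ∑ i, ∑ j, (A + Aᵀ) i j ^ 2 := by
    rw [Finset.mul_sum]
    refine Finset.sum_congr rfl fun i _ => ?_
    rw [Finset.mul_sum]
    refine Finset.sum_congr rfl fun j _ => ?_
    rw [Matrix.smul_apply, smul_eq_mul]
    ring
  rw [hsq, hfrob, hs2]
  have h6 := six_mul_sq_mid_le_sum_sq h10 h21 hsum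
  linarith

end Summit.NavierStokesRegularity.NavierStokesRegularity.Theorems
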